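import Mathlib.RingTheory.PowerSeries.Order
import Mathlib.RingTheory.DiscreteValuationRing.Basic
import Summits.BirchSwinnertonDyer.BirchSwinnertonDyer.Theorems.ResidualThetaTransportAtTwoLambdaLowerBoundO
import HarnessLib

/-!
# `ϖ`-adic exhaustion in `𝒪⟦T⟧`: an element divisible (up to powers of `ϖ`) by polynomials whose reductions
# have unbounded `T`-order is `0` — the kernel brick behind «`L⁻_g` is unique» (PROMOTE-S2 §2(b), crux (R≥)ᵖ)

Route `ResidualThetaTransportAtTwo` (RTT), crux (R≥)ᵖ `ResidualThetaCountLowerPureAtTwo` (stmt-BirchSwinnertonDyer-26074),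
line «bt26-lambda», stub S2 `stub_cmLambdaLower`; memo `Cruxes/ResidualThetaCountLowerPureAtTwo/PROMOTE-S2.md` §2(b) and §3(ii)
(«two elements of `Λ_𝒪` with the same values at all even-level characters are equal — kernel»). Seat `prover-bsd-rtt-w2` g0
(RTT width 2 of director-bsd g13 (195); `--supports`, closes nothing). THEOREMS ONLY, pure commutative algebra (no definition,
no named fact, no instance, no `sorry`); nothing about any curve, form or Selmer group; BSD is not proved by any of this.

WHY. S2 reads `d = λ(L⁻_g)` off a Pollack pair `(L⁺, L⁻)` of the CM form `g` over `𝒪 = 𝒪_{ℚ₂(ι K_g)}` (`IsPollackPairK`: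
`θ_n(g)^ι ≡ ε_n ω_n^∓ L^± (mod ω_n)` in `𝒪⟦T⟧ ⊗ ℚ`, up to a bounded power of `p`). Two solutions `L⁻, L⁻'` differ by an
`x ∈ 𝒪⟦T⟧` with `p^{m_n} · x ∈ (T·ω_n^+)·𝒪⟦T⟧` for every even `n` (cancel `ω_n^-` in the domain `ℚ̄_p⟦T⟧`,
`T ω_n^+ ω_n^- = ω_n`), and `T·ω_n^+ ≡ T^{1 + Σ_{2k ≤ n} φ(p^{2k})}` modulo the maximal ideal. This file proves the algebra that
concludes `x = 0` from such data, WITHOUT unique factorisation or Weierstrass preparation in `𝒪⟦T⟧`: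

* §1 (any domain `O`, any prime element `ϖ`, `π : O → O/ϖ`):
  `exists_eq_C_mul_of_map_eq_zero` (a power series that dies mod `ϖ` is `C ϖ · y'`),
  `exists_eq_C_mul_of_mul_eq_C_mul` (**cancellation**: `f·y = ϖ·z` with `f̄ ≠ 0` ⇒ `y = ϖ·y'`, `f·y' = z`, as `(O/ϖ)⟦T⟧` is a
  domain), `dvd_of_mul_eq_C_pow_mul` (`f·y = ϖ^m·x`, `f̄ ≠ 0` ⇒ `f ∣ x`), `map_eq_zero_of_forall_dvd` (if `x` has divisors `f`
  with `f̄ ≠ 0` of arbitrarily large `T`-order then `x̄ = 0`: `ord_T` is additive on the domain `(O/ϖ)⟦T⟧`),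
  **`eq_zero_of_forall_dvd`** / **`eq_zero_of_forall_mul_eq_C_pow_mul`**: if moreover `⋂ₖ ϖ^k O = 0` then `x = 0`
  (peel off one `ϖ` at a time: the hypothesis passes from `x = ϖ·x₁` to `x₁`; so every coefficient of `x` is divisible by
  every power of `ϖ`).
* §2 (`𝒪` a discrete valuation ring, `ϖ` a uniformiser): `eq_zero_of_forall_pow_dvd_of_irreducible` (`⋂ₖ ϖ^k 𝒪 = 0`) and the
  brick over the CRUX'S CARRIERS `𝒪 = padicCoeffIntegers S`, `Λ_𝒪 = IwasawaAlgebraO S` (`S = Set.range ι`, `ℚ_p(S)/ℚ_p` finite):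
  `eq_zero_of_forall_mul_eq_C_mul_of_irreducible` (any constant `c ≠ 0` for `ϖ^m`), **`eq_zero_of_forall_mul_eq_C_mul_iwasawaAlgebraO`**.

The application to `IsPollackPairK` (uniqueness of `L⁻`, `L⁺`) is the sibling file `…PollackPairKUnique`.

References: [Washington1997] §7.1 (distinguished polynomials, `𝒪⟦T⟧/(p)` = `k⟦T⟧` a domain), Prop. 7.2 (division);
[Pollack2003] Thm. 5.1 (uniqueness of `L_p^±` from the interpolation property), §6.5 (`T ω_n^+ ω_n^- = ω_n`);
[NeukirchANT1999] Ch. II (4.8) (`𝒪_E` a DVR).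
-/

set_option autoImplicit false
-- the Theorems namespace of this sub repeats the summit name by design (D-0017 nested layout)
set_option linter.dupNamespace false

noncomputable section

open scoped Classical

namespace Summit.BirchSwinnertonDyer.BirchSwinnertonDyer.Theorems.PollackPairKUnique

open PowerSeries

universe u

/-! ### §1. Peeling off `ϖ` in `O⟦T⟧` for a prime element `ϖ` of a domain `O` -/

section Generic

variable {O : Type u} [CommRing O] [IsDomain O] {ϖ : O}

omit [IsDomain O] in
/-- A power series all of whose coefficients vanish modulo `ϖ` is `C ϖ · y'` (choose the quotients coefficientwise).
[cite: Washington1997, §7.1] -/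
theorem exists_eq_C_mul_of_map_eq_zero {y : PowerSeries O}
    (hy : PowerSeries.map (Ideal.Quotient.mk (Ideal.span {ϖ})) y = 0) :
    ∃ y' : PowerSeries O, y = C ϖ * y' := by
  have hcoeff : ∀ k : ℕ, ϖ ∣ coeff k y := by
    intro k
    have h := congrArg (coeff k) hy
    rw [coeff_map, map_zero, Ideal.Quotient.eq_zero_iff_mem, Ideal.mem_span_singleton] at h
    exact h
  choose q hq using hcoeff
  refine ⟨PowerSeries.mk q, ?_⟩
  ext k
  rw [coeff_C_mul, coeff_mk]
  exact hq k

/-- **Cancellation of one `ϖ`.** For `ϖ` prime: if `f·y = ϖ·z` in `O⟦T⟧` and `f` does not die modulo `ϖ`, then `y = ϖ·y'`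
with `f·y' = z` — reduce to the DOMAIN `(O/ϖ)⟦T⟧`, where `f̄·ȳ = 0` forces `ȳ = 0`.
[cite: Washington1997, §7.1 (`𝒪⟦T⟧/(p) = k⟦T⟧` is a domain)] -/
theorem exists_eq_C_mul_of_mul_eq_C_mul (hϖ : Prime ϖ) {f y z : PowerSeries O}
    (hf : PowerSeries.map (Ideal.Quotient.mk (Ideal.span {ϖ})) f ≠ 0) (h : f * y = C ϖ * z) :
    ∃ y' : PowerSeries O, y = C ϖ * y' ∧ f * y' = z := by
  haveI : (Ideal.span {ϖ}).IsPrime := (Ideal.span_singleton_prime hϖ.ne_zero).mpr hϖ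
  haveI : IsDomain (O ⧸ Ideal.span {ϖ}) := (Ideal.Quotient.isDomain_iff_prime _).mpr inferInstance
  have hred : PowerSeries.map (Ideal.Quotient.mk (Ideal.span {ϖ})) f *
      PowerSeries.map (Ideal.Quotient.mk (Ideal.span {ϖ})) y = 0 := by
    rw [← map_mul, h, map_mul, map_C, Ideal.Quotient.eq_zero_iff_mem.mpr (Ideal.mem_span_singleton_self ϖ),
      map_zero, zero_mul]
  have hy : PowerSeries.map (Ideal.Quotient.mk (Ideal.span {ϖ})) y = 0 :=
    (mul_eq_zero.mp hred).resolve_left hf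
  obtain ⟨y', rfl⟩ := exists_eq_C_mul_of_map_eq_zero hy
  refine ⟨y', rfl, ?_⟩
  have hC : (C ϖ : PowerSeries O) ≠ 0 := by
    intro h0
    exact hϖ.ne_zero (by simpa using congrArg (coeff 0) h0)
  rw [mul_left_comm] at h
  exact mul_left_cancel₀ hC h

/-- `f·y = ϖ^m·x` with `f̄ ≠ 0` gives `f ∣ x` (cancel `ϖ` `m` times). [cite: Washington1997, §7.1] -/
theorem dvd_of_mul_eq_C_pow_mul (hϖ : Prime ϖ) {f x : PowerSeries O}
    (hf : PowerSeries.map (Ideal.Quotient.mk (Ideal.span {ϖ})) f ≠ 0) :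
    ∀ (m : ℕ) (y : PowerSeries O), f * y = C (ϖ ^ m) * x → f ∣ x := by
  intro m
  induction m with
  | zero =>
    intro y h
    rw [pow_zero, map_one, one_mul] at h
    exact ⟨y, h.symm⟩
  | succ m ih =>
    intro y h
    rw [pow_succ', map_mul, mul_assoc] at h
    obtain ⟨y', -, hy'⟩ := exists_eq_C_mul_of_mul_eq_C_mul hϖ hf h
    exact ih y' hy'

omit [IsDomain O] in
/-- If `x ∈ O⟦T⟧` has, for every `N`, a divisor `f` whose reduction modulo `ϖ` is non-zero of `T`-order `≥ N`, then every
coefficient of `x` is divisible by `ϖ` (`x̄ = f̄·ȳ` has `T`-order `≥ N` for all `N` in the domain `(O/ϖ)⟦T⟧`).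
[cite: Washington1997, §7.1] -/
theorem map_eq_zero_of_forall_dvd (hϖ : Prime ϖ) {x : PowerSeries O}
    (H : ∀ N : ℕ, ∃ f : PowerSeries O, PowerSeries.map (Ideal.Quotient.mk (Ideal.span {ϖ})) f ≠ 0 ∧
      (N : ℕ∞) ≤ (PowerSeries.map (Ideal.Quotient.mk (Ideal.span {ϖ})) f).order ∧ f ∣ x) :
    PowerSeries.map (Ideal.Quotient.mk (Ideal.span {ϖ})) x = 0 := by
  haveI : (Ideal.span {ϖ}).IsPrime := (Ideal.span_singleton_prime hϖ.ne_zero).mpr hϖ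
  haveI : IsDomain (O ⧸ Ideal.span {ϖ}) := (Ideal.Quotient.isDomain_iff_prime _).mpr inferInstance
  rw [← order_eq_top, ENat.eq_top_iff_forall_ge]
  intro N
  obtain ⟨f, -, hN, y, rfl⟩ := H N
  rw [map_mul, order_mul]
  exact hN.trans le_self_add

/-- **`ϖ`-adic exhaustion.** Let `ϖ` be a prime element of the domain `O` with `⋂ₖ ϖ^k O = 0`. If `x ∈ O⟦T⟧` admits, for every
`N`, a divisor `f` with `f̄ ≠ 0` of `T`-order `≥ N` modulo `ϖ`, then `x = 0`: by `map_eq_zero_of_forall_dvd`, `x = ϖ·x₁`; the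
divisors of `x` divide `x₁` (cancellation); iterate, so `ϖ^k` divides every coefficient of `x` for every `k`.
[cite: Washington1997, §7.1 and Prop. 7.2] -/
theorem eq_zero_of_forall_dvd (hϖ : Prime ϖ) (hsep : ∀ a : O, (∀ k : ℕ, ϖ ^ k ∣ a) → a = 0) {x : PowerSeries O}
    (H : ∀ N : ℕ, ∃ f : PowerSeries O, PowerSeries.map (Ideal.Quotient.mk (Ideal.span {ϖ})) f ≠ 0 ∧
      (N : ℕ∞) ≤ (PowerSeries.map (Ideal.Quotient.mk (Ideal.span {ϖ})) f).order ∧ f ∣ x) :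
    x = 0 := by
  -- the hypothesis is inherited by `x₁` when `x = ϖ·x₁`
  have hstep : ∀ x : PowerSeries O,
      (∀ N : ℕ, ∃ f : PowerSeries O, PowerSeries.map (Ideal.Quotient.mk (Ideal.span {ϖ})) f ≠ 0 ∧
        (N : ℕ∞) ≤ (PowerSeries.map (Ideal.Quotient.mk (Ideal.span {ϖ})) f).order ∧ f ∣ x) →
      ∃ x₁ : PowerSeries O, x = C ϖ * x₁ ∧
        ∀ N : ℕ, ∃ f : PowerSeries O, PowerSeries.map (Ideal.Quotient.mk (Ideal.span {ϖ})) f ≠ 0 ∧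
          (N : ℕ∞) ≤ (PowerSeries.map (Ideal.Quotient.mk (Ideal.span {ϖ})) f).order ∧ f ∣ x₁ := by
    intro x Hx
    obtain ⟨x₁, rfl⟩ := exists_eq_C_mul_of_map_eq_zero (map_eq_zero_of_forall_dvd hϖ Hx)
    refine ⟨x₁, rfl, fun N ↦ ?_⟩
    obtain ⟨f, hf, hN, y, hy⟩ := Hx N
    obtain ⟨y', -, hy'⟩ := exists_eq_C_mul_of_mul_eq_C_mul hϖ hf hy.symm
    exact ⟨f, hf, hN, y', hy'.symm⟩
  -- hence `x = ϖ^k · x_k` for every `k`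
  have hpow : ∀ k : ℕ, ∀ x : PowerSeries O,
      (∀ N : ℕ, ∃ f : PowerSeries O, PowerSeries.map (Ideal.Quotient.mk (Ideal.span {ϖ})) f ≠ 0 ∧
        (N : ℕ∞) ≤ (PowerSeries.map (Ideal.Quotient.mk (Ideal.span {ϖ})) f).order ∧ f ∣ x) →
      ∃ xk : PowerSeries O, x = C (ϖ ^ k) * xk := by
    intro k
    induction k with
    | zero => exact fun x _ ↦ ⟨x, by rw [pow_zero, map_one, one_mul]⟩
    | succ k ih =>
      intro x Hx
      obtain ⟨x₁, rfl, Hx₁⟩ := hstep x Hx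
      obtain ⟨xk, hxk⟩ := ih x₁ Hx₁
      exact ⟨xk, by rw [hxk, ← mul_assoc, ← map_mul, ← pow_succ']⟩
  ext i
  rw [map_zero]
  refine hsep _ fun k ↦ ?_
  obtain ⟨xk, hxk⟩ := hpow k x H
  rw [hxk, coeff_C_mul]
  exact dvd_mul_right _ _

/-- The same with the divisibility hypothesis in the shape the Pollack congruences produce: for every `N` there are `f, y` and an
exponent `m` with `f̄ ≠ 0`, `ord_T f̄ ≥ N` and `f·y = ϖ^m·x`. [cite: Washington1997, §7.1 and Prop. 7.2]
[cite: Pollack2003, Thm. 5.1 (uniqueness)] -/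
theorem eq_zero_of_forall_mul_eq_C_pow_mul (hϖ : Prime ϖ) (hsep : ∀ a : O, (∀ k : ℕ, ϖ ^ k ∣ a) → a = 0)
    {x : PowerSeries O}
    (H : ∀ N : ℕ, ∃ (f y : PowerSeries O) (m : ℕ), PowerSeries.map (Ideal.Quotient.mk (Ideal.span {ϖ})) f ≠ 0 ∧
      (N : ℕ∞) ≤ (PowerSeries.map (Ideal.Quotient.mk (Ideal.span {ϖ})) f).order ∧ f * y = C (ϖ ^ m) * x) :
    x = 0 := by
  refine eq_zero_of_forall_dvd hϖ hsep fun N ↦ ?_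
  obtain ⟨f, y, m, hf, hN, h⟩ := H N
  exact ⟨f, hf, hN, dvd_of_mul_eq_C_pow_mul hϖ hf m y h⟩

end Generic

/-! ### §2. Discrete valuation rings, and the crux's carriers `𝒪 = padicCoeffIntegers S`, `Λ_𝒪 = IwasawaAlgebraO S` -/

section DVR

variable {O : Type u} [CommRing O] [IsDomain O] [IsDiscreteValuationRing O] {ϖ : O}

/-- In a discrete valuation ring, an element divisible by every power of a uniformiser is `0` (write `a = u·ϖⁿ`).
[cite: NeukirchANT1999, Ch. II (4.8)] -/
theorem eq_zero_of_forall_pow_dvd_of_irreducible (hϖ : Irreducible ϖ) (a : O) (h : ∀ k : ℕ, ϖ ^ k ∣ a) : a = 0 := by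
  by_contra ha
  obtain ⟨n, u, rfl⟩ := IsDiscreteValuationRing.eq_unit_mul_pow_irreducible ha hϖ
  have hdvd : ϖ * ϖ ^ n ∣ (u : O) * ϖ ^ n := by
    have := h (n + 1)
    rwa [pow_succ'] at this
  have hu : ϖ ∣ (u : O) := (mul_dvd_mul_iff_right (pow_ne_zero n hϖ.ne_zero)).mp hdvd
  exact hϖ.not_isUnit (isUnit_of_dvd_unit hu u.isUnit)

/-- The exhaustion brick over a DVR: `ϖ` a uniformiser, `x ∈ O⟦T⟧` with divisors `f` (`f̄ ≠ 0`, `ord_T f̄ → ∞`) of `ϖ^m·x`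
⇒ `x = 0`. [cite: Washington1997, §7.1 and Prop. 7.2] [cite: Pollack2003, Thm. 5.1 (uniqueness)] -/
theorem eq_zero_of_forall_mul_eq_C_pow_mul_of_irreducible (hϖ : Irreducible ϖ) {x : PowerSeries O}
    (H : ∀ N : ℕ, ∃ (f y : PowerSeries O) (m : ℕ), PowerSeries.map (Ideal.Quotient.mk (Ideal.span {ϖ})) f ≠ 0 ∧
      (N : ℕ∞) ≤ (PowerSeries.map (Ideal.Quotient.mk (Ideal.span {ϖ})) f).order ∧ f * y = C (ϖ ^ m) * x) :
    x = 0 :=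
  eq_zero_of_forall_mul_eq_C_pow_mul hϖ.prime (eq_zero_of_forall_pow_dvd_of_irreducible hϖ) H

/-- The same with an ARBITRARY non-zero constant `c` in place of `ϖ^m` (`c = u·ϖ^m` in a DVR): `f·y = c·x` with `f̄ ≠ 0` of
unbounded `T`-order ⇒ `x = 0`. This is the shape produced by congruences «up to a bounded power of `p`» (`IsCongrModOmegaO`).
[cite: Washington1997, §7.1 and Prop. 7.2] [cite: Pollack2003, Thm. 5.1 (uniqueness)] -/
theorem eq_zero_of_forall_mul_eq_C_mul_of_irreducible (hϖ : Irreducible ϖ) {x : PowerSeries O}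
    (H : ∀ N : ℕ, ∃ (f y : PowerSeries O) (c : O), c ≠ 0 ∧ PowerSeries.map (Ideal.Quotient.mk (Ideal.span {ϖ})) f ≠ 0 ∧
      (N : ℕ∞) ≤ (PowerSeries.map (Ideal.Quotient.mk (Ideal.span {ϖ})) f).order ∧ f * y = C c * x) :
    x = 0 := by
  refine eq_zero_of_forall_mul_eq_C_pow_mul_of_irreducible hϖ fun N ↦ ?_
  obtain ⟨f, y, c, hc, hf, hN, h⟩ := H N
  obtain ⟨m, u, rfl⟩ := IsDiscreteValuationRing.eq_unit_mul_pow_irreducible hc hϖ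
  refine ⟨f, C ((u⁻¹ : Oˣ) : O) * y, m, hf, hN, ?_⟩
  rw [mul_left_comm, h, ← mul_assoc, ← map_mul, ← mul_assoc, Units.inv_mul, one_mul]

end DVR

section Crux

open Literature.NumberTheory.EllipticCurves

variable {p : ℕ} [Fact p.Prime] (S : Set (PadicAlgCl p)) [FiniteDimensional ℚ_[p] (padicCoeffField S)]

/-- **The brick over the crux's carriers.** For `𝒪 = padicCoeffIntegers S` (`S = Set.range ι`, `ℚ_p(S)/ℚ_p` finite — a DVR,
`LambdaLowerBoundO.isDiscreteValuationRing_unitBall` along `padicCoeffIntegers_eq_unitBall`), a uniformiser `ϖ`, and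
`x ∈ Λ_𝒪 = IwasawaAlgebraO S = 𝒪⟦T⟧`: if for every `N` there are `f, y ∈ Λ_𝒪` and a constant `c ≠ 0` of `𝒪` with
`f ≢ 0 (mod ϖ)` of `T`-order `≥ N` modulo `ϖ` and `f·y = c·x`, then `x = 0`. (For the Pollack congruences: `f = T·ω_n^+`,
`n` even, whose reduction is `T^{1+Σφ(p^{2k})}`, and `c = p^m`.) [cite: Pollack2003, Thm. 5.1 (uniqueness)]
[cite: Washington1997, §7.1 and Prop. 7.2] -/
theorem eq_zero_of_forall_mul_eq_C_mul_iwasawaAlgebraO :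
    ∀ (ϖ : padicCoeffIntegers S), Irreducible ϖ → ∀ (x : IwasawaAlgebraO S),
      (∀ N : ℕ, ∃ (f y : IwasawaAlgebraO S) (c : padicCoeffIntegers S), c ≠ 0 ∧
        PowerSeries.map (Ideal.Quotient.mk (Ideal.span {ϖ})) f ≠ 0 ∧
        (N : ℕ∞) ≤ (PowerSeries.map (Ideal.Quotient.mk (Ideal.span {ϖ})) f).order ∧
        f * y = PowerSeries.C c * x) → x = 0 := by
  unfold IwasawaAlgebraO
  rw [padicCoeffIntegers_eq_unitBall S]
  intro ϖ hϖ x H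
  haveI := LambdaLowerBoundO.isDiscreteValuationRing_unitBall p (padicCoeffField S)
  exact eq_zero_of_forall_mul_eq_C_mul_of_irreducible hϖ H

end Crux

end Summit.BirchSwinnertonDyer.BirchSwinnertonDyer.Theorems.PollackPairKUnique

end
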